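import Literature.NumberTheory.LFunctions.Zhang2022.KnifeEdgeEllScales
import Literature.NumberTheory.LFunctions.Zhang2022.TypedSection14

/-!
# Zhang (2022), rung F-S3 (Landau–Siegel programme, family B-ell / edge ℓ₀ = 1): the needed estimate
# `Eq148DUniform` — (14.8) on the large-conductor range, D-uniformly at free scales `P = D^A`, `T = D^B`

Y. Zhang, *Discrete mean estimates and the Landau–Siegel zero*, arXiv:2211.02515v1 (2022)
[Zhang2022LandauSiegel] — an unrefereed manuscript under adjudication. **WHAT THIS IS NOT: not a claim about
Theorems 1–2 of arXiv:2211.02515, about Landau–Siegel zeros, or about Parity; `Eq148DUniform` is a bare `Prop` —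
the NEEDED ESTIMATE E-016 (alias ell-E1) of the cell's registry `obj/EDREGISTRY.md`: an extension of the manuscript's
(14.8) to free scales that is NOT stated in the manuscript (which pins `P = exp 𝓛⁹`), NOT proved anywhere in print
(status open-in-print), and asserted by no one — designs of family B-ell take it as a HYPOTHESIS, exactly as
`KnifeEdge.EStarLen` (E-001) is taken by family B-len. The programme SEARCHES and TYPES.**

## Why this statement (ELL-CENSUS v1.0 7da82e17808713c2 of record, §0/§4; director-frontier 14:21:19Z (2)(b))

At the manuscript's pinned scales every §§14–17 error term is free. At the ℓ-lever's scales `P = D^A`,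
`T = D^B` (`B = 3·10⁻⁴A` ordered; `B ≤ 2·10⁻⁴A` print-exact) the census of record finds exactly ONE printed
error term that is neither regime-free nor a `D`-power saving: **E4 = (14.8) on the large-conductor range
`D³ ≤ r < 2DP₄`** (tex l.3948–3964: «Mellin transform, Lemma 5.4 (i) and the large sieve inequality»), whose
reconstructed relative size is `D^{1/2−B}𝓛^{O(1)}/𝔞` — `o(main)` iff `B > 1/2` (`A > 1667`, outside the
zero-model/ι window `A ≤ 1590`). So on every sheet with `B ≤ 1/2` a `B-ell` design needs THIS estimate, re-proved
uniformly in `D`: the named first loss of the census.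

## What is typed (statement-first; one `def … : Prop`, free-scale twins of the typed §14 objects)

* Part 1 — the (14.8) objects of `Typed.Sec14` at FREE scales `S : EllScales.Scales` (p456970): `Eq142At S`
  ((14.2) with `P₄ ↦ S.P4`), `DeltaAt S` (`Δ` of (5.7) at `(S.L2, S.t0)`), `rhs1417OnAt S χ κs R` (the u017
  majorant of the left side of (14.8) with `P ↦ S.P`, `p ∼ P ↦ S.primeWindow`, `Δ ↦ DeltaAt S`, restricted to
  `r ∈ R`), `largeConductorRange S D = {D³ ≤ r < 2D·S.P4}`; regressions `…_pinned : … (Scales.pinned D) = Typed.Sec14.…`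
  by `rfl` (so nothing of §14 is restated).
* Part 2 — `scalesAt A B D` (`log P = A·log D`, `log T = B·log D`; `t₀, 𝓛₁, 𝓛₂, η` pinned) and
  **`Eq148DUniform A B`**: for every implied constant `Bτ` of (14.1)–(14.2) there are `c > 0`, `C` such that for all
  large `D`, every real primitive `χ (mod D)` with (A), and all coefficient sequences `𝐤*, 𝐚*` obeying (14.1)–(14.2)
  at `S = scalesAt A B D`: `rhs1417OnAt S χ 𝐤* (largeConductorRange S D) ≤ C·S.P²·D^{−c}` — the printed TARGET of
  (14.8) on the printed RANGE, with the printed HYPOTHESES, at free `(A, B)`. `Eq148DUniformWindow I B` = the same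
  for every `A ∈ I` with `B = B(A)` (a design declares its `A`-window).
* Part 3 — bookkeeping proved here: `rhs1417OnAt_nonneg`, `rhs1417OnAt_mono` (range-monotone),
  `eq148DUniform_of_superset` (a bound on a larger `r`-range implies it on the printed one).

## GAP NOTE — needed (b) minus printed (a) (ELL-CENSUS §5; ls-ref-1 VERDICTS.md §2a 61480bfa2c3e224c)

(a) IN PRINT / IN TREE: `Literature.NumberTheory.LFunctions.DukeFriedlanderIwaniec1997_bilinearKloostermanFractions`
(DFI, Invent. Math. 128 (1997) Thm 2, twisted form; PROVED in the tree): `‖ΣΣ_{(m,n)=1} α_m β_n e(k m̄/n + X/mn)‖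
≤ K_ε‖α‖‖β‖(1+|X|/MN)(|k|+MN)^{3/8}(M+N)^{11/48+ε}` on boxes `m ∼ M`, `n ∼ N`, general coefficients; Bettin–Chandee
2018 Thm 1 (`BettinChandee2018_trilinearKloostermanFractions`, implies DFI); arXiv:2604.25177 Thm 2.1 (trilinear
`ΣΣΣ α_m β_n ν_a e(ϑ a m̄/(nR))` with a FIXED factor `R` in the denominator — structurally nearest: `a = l`, `m = p`,
`nR = kD`). (b) NEEDED here: a TRILINEAR bound with `p` PRIME `∼ P`, the long variable `l` of length
`≍ p·(Dk)·(t₀ ± C𝓛₂)` carrying the STRUCTURED coefficient `κ*(dl)` (`κ* = κ₁∗b`, `κ₁ ∋ μ` from `ζ(s+β₁)ζ(s+β₂)/ζ(s)`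
— tex l.4063 — so no smooth-completion escape; `b` supported on `n ≤ PT⁻²`), modulus `Dk` with the FIXED factor
`D`, `k ≤ 2PT⁻²t₀`, smoothly weighted by `Δ(l/(p·h·r))`, uniform in `D`, SAVING `D^{1/2−B+ε}` over the
multiplicative large sieve. ls-ref-1's count: DFI97/BC18 applied directly save `P^{1/8}` against a needed
`≈ P·D^{1/2−2B}` — NEGATIVE as a stand-alone route (price XL). LEVEL-OF-DISTRIBUTION FORM of the live content
(ls-ref-1 16:32:38Z, verbatim): «`κ₁∗b` equidistributed (additive twists `e(−l c/q)`) to moduli `q = D·k` at level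
`x^{1/2}·D^{1/2−B} = 1/2 + ϖ`, `ϖ ∈ [7·10⁻⁶, 1.2·10⁻⁴]`, smoothly averaged over `k ≤ 2PT⁻²t₀/d`, with `c = p̄`
running over primes `p ∼ P < q` and weight `χ(p)`» — a dispersion-beyond-`1/2` problem whose moduli are neither
well-factorable-weighted nor densely divisible and whose residue is prime-coupled. The SAME missing tool as the
transfer lever's `Eq711Long` (FEASIBILITY v1.0b §1 Lever B).

Deliberately NOT here: any proof or refutation of `Eq148DUniform` (none exists in print); the (Z)-half E-007Z and the budget rows
ell-E3/E4 (ls-Bell-typer-1); the printed fixed-`A` window row E-019 (`B > 1/2`).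
-/

noncomputable section

open Complex Real ComplexConjugate

namespace Literature.NumberTheory.LFunctions.Zhang2022.KnifeEdge

open Skeleton EllScales Typed.Sec14

/-! ## Part 1 — the (14.8) objects at free scales -/

/-- (14.2) at free scales: "`a*(n) ≪ 1`, `a*(n) = 0` if `n > 2P₄`" with `P₄ = S.P4 = PT⁻²t₀` of the scale record
(`= Typed.Sec14.Eq142 D` at `S = Scales.pinned D`, `eq142At_pinned`). [cite: Zhang2022LandauSiegel, §14 (14.2) p.76] -/
def Eq142At (S : Scales) (B : ℝ) (as : ℕ → ℂ) : Prop :=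
  (∀ n : ℕ, ‖as n‖ ≤ B) ∧ ∀ n : ℕ, 2 * S.P4 < n → as n = 0

/-- `Δ(x)` of (5.6)–(5.7) at the free parameters `(𝓛₂, t₀) = (S.L2, S.t0)` (`= Skeleton.DeltaW D` at the pinned
scales, `deltaAt_pinned`). [cite: Zhang2022LandauSiegel, §5 (5.7)] -/
def DeltaAt (S : Scales) (x : ℝ) : ℂ := Lemma53.Delta57 S.L2 S.t0 x

variable {D : ℕ} [NeZero D] (χ : DirichletCharacter ℂ D)

/-- **The u017 majorant of the left side of (14.8) at free scales**, `r`-sum restricted to `r ∈ R`: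
`Σ_d d⁻¹ Σ_{r∈R} Σ_{h<P/r, h≡0 (D/(D,r))} D/(φ(hr)h√r) Σ*_{θ (mod r), θ≠χ} |Σ_{(l,h)=1} κ*(dl)θ(l) Σ_{p∼P} χθ̄(p)Δ(l/(phr))|`
with `P = S.P`, `P₄ = S.P4`, `p ∼ P` = `S.primeWindow`, `Δ = DeltaAt S` (`= Typed.Sec14.rhs1417On` at the pinned
scales, `rhs1417OnAt_pinned`). [cite: Zhang2022LandauSiegel, §14 u017 p.79, tex L3956] -/
def rhs1417OnAt (S : Scales) (κs : ℕ → ℂ) (R : Finset ℕ) : ℝ :=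
  ∑ d ∈ Finset.Icc 1 ⌊2 * S.P4⌋₊, (d : ℝ)⁻¹ * ∑ r ∈ R,
    ∑ h ∈ (Finset.Ico 1 ⌈S.P / r⌉₊).filter (fun h => D / Nat.gcd D r ∣ h),
      (D : ℝ) / ((Nat.totient (h * r) : ℝ) * h * Real.sqrt r) *
        ∑ θ ∈ finsetOf {θ : DirichletCharacter ℂ r | θ.IsPrimitive ∧
            DirichletCharacter.changeLevel (dvd_mul_left r D) θ ≠
              DirichletCharacter.changeLevel (dvd_mul_right D r) χ},
          ‖∑' l : ℕ, if Nat.Coprime l h then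
              κs (d * l) * θ (l : ZMod r) *
                ∑ p ∈ S.primeWindow, χ (p : ZMod D) * θ⁻¹ (p : ZMod r) *
                  DeltaAt S ((l : ℝ) / ((p : ℝ) * h * r)) else 0‖

omit [NeZero D] χ in
/-- **The large-conductor range of (14.8)** at free scales: `D³ ≤ r < 2DP₄` ("for `D³ ≤ r < 2DP₄` we use … the large
sieve inequality", p. 79), as the `Finset` of `Typed.Sec14.Eq148leg2` with `P₄ = S.P4`.
[cite: Zhang2022LandauSiegel, §14 (14.8) (proof) p.79, tex L3962–L3963] -/
def largeConductorRange (S : Scales) (D : ℕ) : Finset ℕ :=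
  (Finset.Ico 2 ⌈2 * (D : ℝ) * S.P4⌉₊).filter (fun r => ¬ r < D ^ 3)

/-! ### Regressions at the pinned scales (nothing of §14 is restated) -/

omit [NeZero D] χ in
/-- At the pinned scales (14.2) is the typed node. [cite: Zhang2022LandauSiegel, §14 (14.2) p.76] -/
theorem eq142At_pinned (D : ℕ) (B : ℝ) (as : ℕ → ℂ) : Eq142At (Scales.pinned D) B as ↔ Eq142 D B as := Iff.rfl

omit [NeZero D] χ in
/-- At the pinned scales `Δ` is the skeleton's `DeltaW`. [cite: Zhang2022LandauSiegel, §5 (5.7)] -/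
theorem deltaAt_pinned (D : ℕ) (x : ℝ) : DeltaAt (Scales.pinned D) x = DeltaW D x := rfl

omit [NeZero D] in
/-- At the pinned scales the free majorant IS the typed u017 majorant `Typed.Sec14.rhs1417On`.
[cite: Zhang2022LandauSiegel, §14 u017 p.79] -/
theorem rhs1417OnAt_pinned (κs : ℕ → ℂ) (R : Finset ℕ) :
    rhs1417OnAt χ (Scales.pinned D) κs R = rhs1417On χ κs R := rfl

omit [NeZero D] χ in
/-- At the pinned scales the large-conductor range is the one of `Typed.Sec14.Eq148leg2`.
[cite: Zhang2022LandauSiegel, §14 (14.8) (proof) p.79] -/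
theorem largeConductorRange_pinned (D : ℕ) :
    largeConductorRange (Scales.pinned D) D =
      (Finset.Ico 2 ⌈2 * (D : ℝ) * P4 D⌉₊).filter (fun r => ¬ r < D ^ 3) := rfl

/-! ### Bookkeeping -/

omit [NeZero D] in
/-- Every term of the free majorant is non-negative. [cite: Zhang2022LandauSiegel, §14 u017 p.79] -/
theorem rhs1417OnAt_nonneg (S : Scales) (κs : ℕ → ℂ) (R : Finset ℕ) : 0 ≤ rhs1417OnAt χ S κs R := by
  unfold rhs1417OnAt
  refine Finset.sum_nonneg fun d _ => mul_nonneg (inv_nonneg.mpr (Nat.cast_nonneg d)) ?_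
  refine Finset.sum_nonneg fun r _ => Finset.sum_nonneg fun h _ => mul_nonneg ?_ ?_
  · exact div_nonneg (Nat.cast_nonneg D)
      (mul_nonneg (mul_nonneg (Nat.cast_nonneg _) (Nat.cast_nonneg h)) (Real.sqrt_nonneg r))
  · exact Finset.sum_nonneg fun θ _ => norm_nonneg _

omit [NeZero D] in
/-- The free majorant is monotone in the `r`-range. [cite: Zhang2022LandauSiegel, §14 u017 p.79] -/
theorem rhs1417OnAt_mono (S : Scales) (κs : ℕ → ℂ) {R R' : Finset ℕ} (h : R ⊆ R') :
    rhs1417OnAt χ S κs R ≤ rhs1417OnAt χ S κs R' := by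
  unfold rhs1417OnAt
  refine Finset.sum_le_sum fun d _ => mul_le_mul_of_nonneg_left ?_ (inv_nonneg.mpr (Nat.cast_nonneg d))
  refine Finset.sum_le_sum_of_subset_of_nonneg h fun r _ _ => ?_
  refine Finset.sum_nonneg fun h' _ => mul_nonneg ?_ ?_
  · exact div_nonneg (Nat.cast_nonneg D)
      (mul_nonneg (mul_nonneg (Nat.cast_nonneg _) (Nat.cast_nonneg h')) (Real.sqrt_nonneg r))
  · exact Finset.sum_nonneg fun θ _ => norm_nonneg _

/-! ## Part 2 — the scales `P = D^A`, `T = D^B` and the needed estimate -/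

/-- **The ℓ-lever's scales**: `log P = A·log D`, `log T = B·log D` (`P = D^A`, `T = D^B`), the remaining scales as
printed (`t₀ = 𝓛⁵¹⁹`, `𝓛₁ = 𝓛⁴⁰⁵`, `𝓛₂ = 𝓛⁴⁰⁰`, `η = 𝓛⁻⁶⁸`). [cite: Zhang2022LandauSiegel, §2 (2.6), (2.8), (2.15); §6] -/
def scalesAt (A B : ℝ) (D : ℕ) : Scales where
  D := D
  logP := A * Real.log D
  logT := B * Real.log D
  t0 := Real.log D ^ 519
  L1 := Real.log D ^ 405
  L2 := Real.log D ^ 400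
  eta := (Real.log D ^ 68)⁻¹

/-- `(scalesAt A B D).P = exp(A·log D)` (`= D^A` for `D ≥ 1`). [cite: Zhang2022LandauSiegel, §2 (2.6)] -/
theorem scalesAt_P (A B : ℝ) (D : ℕ) : (scalesAt A B D).P = Real.exp (A * Real.log D) := rfl

/-- `(scalesAt A B D).P = D^A` for `D ≠ 0`. [cite: Zhang2022LandauSiegel, §2 (2.6)] -/
theorem scalesAt_P_eq_rpow (A B : ℝ) {D : ℕ} (hD : D ≠ 0) : (scalesAt A B D).P = (D : ℝ) ^ A := by
  rw [scalesAt_P, Real.rpow_def_of_pos (Nat.cast_pos.mpr (Nat.pos_of_ne_zero hD)), mul_comm]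

/-- `(scalesAt A B D).A = A` (for `log D ≠ 0`). [cite: Zhang2022LandauSiegel, §2 (2.6)] -/
theorem scalesAt_A (A B : ℝ) {D : ℕ} (hD : Real.log D ≠ 0) : (scalesAt A B D).A = A := by
  unfold Scales.A scalesAt; field_simp

/-- `(scalesAt A B D).B = B` (for `log D ≠ 0`). [cite: Zhang2022LandauSiegel, §6] -/
theorem scalesAt_B (A B : ℝ) {D : ℕ} (hD : Real.log D ≠ 0) : (scalesAt A B D).B = B := by
  unfold Scales.B scalesAt; field_simp

/-- **E-016 `Eq148DUniform A B` (alias ell-E1) — THE NEEDED ESTIMATE (a hypothesis `Prop`; open-in-print; NOT stated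
or asserted by the manuscript, which proves this shape only at its pinned scales).** At the scales `P = D^A`, `T = D^B` (the other scales as printed): for every
implied constant `Bτ` of (14.1)–(14.2) there are `c > 0` and `C` such that, for all sufficiently large `D`, every
real primitive `χ (mod D)` satisfying (A), and all sequences `𝐤*`, `𝐚*` with (14.1) `|κ*(m)| ≤ Bτ·τ₅(m)` and (14.2)
`|a*(n)| ≤ Bτ`, `a*(n) = 0` for `n > 2P₄`, the u017 majorant of (14.8) on the LARGE-CONDUCTOR RANGE `D³ ≤ r < 2DP₄`
is `≤ C·P²·D^{−c}` — the printed target of (14.8), D-UNIFORMLY at fixed `(A, B)`. The manuscript proves this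
shape only at `log P = 𝓛⁹` (multiplicative large sieve); at `T = D^B` the printed proof needs `B > 1/2` (registry
row E-019); for `B ≤ 1/2` this `Prop` is the estimate a `B-ell` design must NAME (saving `D^{1/2−B+ε}` over the
large sieve; gap note in the module docstring). [cite: Zhang2022LandauSiegel, §14 (14.8) p.79, tex L3945–L3963] -/
def Eq148DUniform (A B : ℝ) : Prop :=
  ∀ Bτ : ℝ, ∃ c : ℝ, 0 < c ∧ ∃ C : ℝ, ForAllLarge fun D _ χ => AssumptionA D χ →
    ∀ κs as : ℕ → ℂ, Eq141 Bτ κs → Eq142At (scalesAt A B D) Bτ as →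
      rhs1417OnAt χ (scalesAt A B D) κs (largeConductorRange (scalesAt A B D) D)
        ≤ C * (scalesAt A B D).P ^ 2 * (D : ℝ) ^ (-c)

/-- **The windowed form a design declares**: `Eq148DUniform` at every `A` of the design's `A`-window `I` with the
tied `T`-exponent `B = b(A)` (ordered `b(A) = 3·10⁻⁴A`; print-exact `b(A) ≤ 2·10⁻⁴A`).
[cite: Zhang2022LandauSiegel, §14 (14.8) p.79] -/
def Eq148DUniformWindow (I : Set ℝ) (b : ℝ → ℝ) : Prop := ∀ A ∈ I, Eq148DUniform A (b A)

/-! ## Part 3 — bookkeeping implications -/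

/-- The windowed form on a sub-window. [cite: Zhang2022LandauSiegel, §14 (14.8) p.79] -/
theorem eq148DUniformWindow_mono {I J : Set ℝ} (h : I ⊆ J) (b : ℝ → ℝ) :
    Eq148DUniformWindow J b → Eq148DUniformWindow I b :=
  fun hJ A hA => hJ A (h hA)

/-- **A bound on a LARGER `r`-range gives `Eq148DUniform`** (range-monotonicity of the non-negative majorant):
if at the scales `scalesAt A B D` the u017 majorant over ranges `R D ⊇ {D³ ≤ r < 2DP₄}` is `≤ C·P²·D^{−c}`
eventually, then `Eq148DUniform A B`. (How a proof covering e.g. all `1 < r < 2DP₄` would be consumed.)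
[cite: Zhang2022LandauSiegel, §14 (14.8) p.79] -/
theorem eq148DUniform_of_superset {A B : ℝ} (R : ℕ → Finset ℕ)
    (hR : ∀ D : ℕ, largeConductorRange (scalesAt A B D) D ⊆ R D)
    (h : ∀ Bτ : ℝ, ∃ c : ℝ, 0 < c ∧ ∃ C : ℝ, ForAllLarge fun D _ χ => AssumptionA D χ →
      ∀ κs as : ℕ → ℂ, Eq141 Bτ κs → Eq142At (scalesAt A B D) Bτ as →
        rhs1417OnAt χ (scalesAt A B D) κs (R D) ≤ C * (scalesAt A B D).P ^ 2 * (D : ℝ) ^ (-c)) :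
    Eq148DUniform A B := by
  intro Bτ
  obtain ⟨c, hc, C, D₀, hD₀⟩ := h Bτ
  refine ⟨c, hc, C, D₀, fun D _ χ hD hq hp hA κs as h1 h2 => ?_⟩
  exact (rhs1417OnAt_mono χ _ κs (hR D)).trans (hD₀ D χ hD hq hp hA κs as h1 h2)

/-! ## Addendum (appended 2026-08-26T17:2xZ) — the live content of `Eq148DUniform` in two more dialects

Custodian sentences adopted for the registry row E-016 (ls-ref-1 16:50:04Z after ls-theory's POISSON-CHECK-148.md
bc75e296c7824b9d), recorded next to the `Prop` so that card levers quote ONE text: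

* EQUIVALENT FORMULATION (ls-theory / ls-ref-1): «equivalently: a D-uniform bi/trilinear Kloosterman-fractions bound,
  inverted variable `p ∼ P` SHORTER than the modulus `n = Dk ≤ 2DPT⁻²t₀`, numerator `≍ n·P·t₀`, coefficients `(μ∗b)` on
  the numerator side and primes with `χ(p)` on the inverted side, saving `≥ D^{1/2−B+c}` beyond θ-expansion + large
  sieve.» The Poisson zero-frequency check does NOT dissolve the `D^{1/2−B}` loss (`κ₁ ∋ μ` carries `l`'s length;
  Poisson acts only in the smooth factors and only past `Dk𝓛^{119}`; the `√` is the GL(1) spectral-expansion cost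
  `|τ(θ*)|` of the basis characters, not `τ(χ)`).
* RANGE TABLE (POISSON-CHECK-148 §4, ls-theory's reading of the tex of record): outer prime `p ∼ P`, prime, weight
  `χ(p)`, `P = D^A`, `A ∈ [≈920, 1590(1 − c/0.638)]`; modulus `n = Dk` (`D₂k` in (14.6)), `k < 2P₄/d`, `P₄ = PT⁻²t₀`
  (l.1689), binding conductor range `r ∈ [D³, 2DP₄)` (l.3962), `D ∣ n` always; numerator `l` with `(l,k) = 1`
  (`(l,Dk) = 1` may be imposed, l.3919/3927), `l ≍ L₀ = Dpk·t₀`, window `N = Dpk·𝓛₂` (Gaussian `Δ`, (5.8)),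
  `N/n = p𝓛₂`; coefficients on `l`: `κ*(dl) = (κ₁∗b)(dl)`, `κ₁ = 1^{(−β₁)}∗1^{(−β₂)}∗μ` (l.4064), `|β_i| < 5α`,
  `b ≪ τ₂`, `supp b ≤ PT⁻²η₊` (15.2), `κ* ≪ τ₅` (14.1); coefficients on `k`: `a*(dk) = g̃₃(dk) = (dk)^{β₃}g*(P₄/(dk))`,
  `supp < 2P₄` ((14.2), l.4077); `d ≥ 1`, `dk < 2P₄`, weight `d⁻¹`; to show: (14.8) `≪ P²D^{−c}` on `D³ ≤ r < 2DP₄`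
  WITHOUT losing `D^{1/2−B}` — required saving over the trivial `D^{1+2A+(A−2B)}`: `D^{A−2B+1/2+c}`; D-uniformity:
  every implied constant independent of `D`; `t₀, 𝓛₂, T` are `D^{o(1)}` but `T = D^B` is kept explicit.

In this file's terms: the outer prime, the modulus range, the `d`- and `h`-sums and the `Δ`-window are literally the
summation structure of `rhs1417OnAt`; `(14.1)`/`(14.2)` are the hypotheses `Eq141`/`Eq142At`; the target is the
right side of `Eq148DUniform`; `T = D^B` enters through `scalesAt A B D` (`S.P4 = P·T⁻²·t₀`).
-/

/-- Bookkeeping for design files: a design declaring a ONE-POINT window `{A}` with tie `b` needs exactly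
`Eq148DUniform A (b A)`. [cite: Zhang2022LandauSiegel, §14 (14.8) p.79] -/
theorem eq148DUniformWindow_singleton (A : ℝ) (b : ℝ → ℝ) :
    Eq148DUniformWindow {A} b ↔ Eq148DUniform A (b A) := by
  constructor
  · exact fun h => h A rfl
  · intro h A' hA'
    rw [Set.mem_singleton_iff] at hA'
    subst hA'
    exact h

/-! ## Addendum 2 — the unconditional (priced) form (ls-ref-1 F5 rider 17:03:10Z) -/

/-- **`Eq148DUniformUncond A B` — the PRICED statement**: the same estimate WITHOUT the guard `AssumptionA D χ →`
(the harmonic-analysis bound — large sieve / Kloosterman fractions — uses no hypothesis on `L(1,χ)`; `χ` stays a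
binder because it enters the majorant through `χθ̄(p)`). Registry E-016 reads: typed = `Eq148DUniform`
(design-facing, ⟨A⟩-guarded like every node of the skeleton) / `Eq148DUniformUncond` (the priced object, XL).
[cite: Zhang2022LandauSiegel, §14 (14.8) p.79, tex L3945–L3963] -/
def Eq148DUniformUncond (A B : ℝ) : Prop :=
  ∀ Bτ : ℝ, ∃ c : ℝ, 0 < c ∧ ∃ C : ℝ, ForAllLarge fun D _ χ =>
    ∀ κs as : ℕ → ℂ, Eq141 Bτ κs → Eq142At (scalesAt A B D) Bτ as →
      rhs1417OnAt χ (scalesAt A B D) κs (largeConductorRange (scalesAt A B D) D)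
        ≤ C * (scalesAt A B D).P ^ 2 * (D : ℝ) ^ (-c)

/-- The unconditional form implies the design-facing (⟨A⟩-guarded) one. [cite: Zhang2022LandauSiegel, §14 (14.8) p.79] -/
theorem eq148DUniform_of_uncond {A B : ℝ} (h : Eq148DUniformUncond A B) : Eq148DUniform A B := by
  intro Bτ
  obtain ⟨c, hc, C, D₀, hD₀⟩ := h Bτ
  exact ⟨c, hc, C, D₀, fun D _ χ hD hq hp _ κs as h1 h2 => hD₀ D χ hD hq hp κs as h1 h2⟩

end Literature.NumberTheory.LFunctions.Zhang2022.KnifeEdge
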